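import Mathlib.RingTheory.LocalRing.MaximalIdeal.Basic
import Mathlib.RingTheory.LocalRing.RingHom.Basic
import Mathlib.RingTheory.Ideal.Colon
import Mathlib.RingTheory.Ideal.Maps
import Mathlib.Algebra.BigOperators.Group.Multiset.Basic
import HarnessLib

/-!
# [OURS · L1 W4.6 rung (i-b)] Admissible divisions of a stalk ideal and its NORMAL FORM (the local bookkeeping of the
# blow-ups of regular curves of the singular locus through a point)
# (cell res-hironaka, LADDER-RESOLUTION rung L, D-0089; campaign s46, prover res-L1-s46-pv-1; host route MarkedTransfer,
# `--supports stmt-ResolutionOfSingularities-16155`)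

HONEST FRAMING. Nothing here is a statement of H. Hironaka's manuscript (2017-03-23, [Hironaka2017]); elementary
commutative algebra in a local domain. AI-written; weaker than expert review. No `sorry`; axioms standard.

## What (and why)

On a surface, blowing up a REGULAR curve `C` of the singular locus of `(J, b)` through a closed point `y` does not change
the local ring `𝒪_y` and replaces the stalk `J_y` by `(J_y : ρ^b)`, `ρ` a local equation of `C` at `y` — a prime element
which is a regular parameter (`ρ ∉ 𝔪_y²`) with `J_y ⊆ (ρ^b)`. Call a product `d = ∏ ρ_i^b` of `b`-th powers of such primes an
ADMISSIBLE DIVISOR, admissible FOR `J` when `J ⊆ (d)`. The NORMAL FORM `normalForm b J = ⨆ (J : d)` over the admissible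
divisors of `J` is the largest ideal obtainable from `J` by such divisions; the per-point termination measure of rung (i-b)
is the loose exit count of the normal form. This file proves the two invariances the measure needs:
`normalForm b (J : ρ^b) = normalForm b J` (a curve blow-up does not change it) and transport under ring isomorphisms,
and computes it for ideals of isolated type (`= J`).

## Contents

* `IsAdmissibleDivisor`, `normalForm`; `le_normalForm`, `colon_le_normalForm`, `normalForm_le_iff`.
* `prod_pow_dvd_of_dvd_mul` — coprime cancellation for products of prime powers in a domain.
* **`normalForm_colon_eq`** — invariance under one admissible division.
* **`normalForm_eq_self_of_isolated`** — `J ⊄ (ρ^b)` for every prime `ρ` ⇒ `normalForm b J = J`.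
* **`map_normalForm`** — transport along a ring isomorphism.

## References

* O. Zariski, P. Samuel, *Commutative Algebra* II (1960), Appendix 5 (proximity; the book-keeping of exceptional
  curves). [ZariskiSamuel1960]
-/

noncomputable section

open IsLocalRing

-- single-problem summit: the doubled namespace component `ResolutionOfSingularities` is forced
set_option linter.dupNamespace false

namespace Summit.ResolutionOfSingularities.ResolutionOfSingularities.Theorems.CampaignW46

universe u

variable {R : Type u} [CommRing R]

/-! ## Admissible divisors and the normal form -/

/-- **An admissible divisor** (for the exponent `b`) of the local ring `R`: a product `∏ ρ_i^b` of `b`-th powers of prime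
elements which are regular parameters (`ρ_i ∉ 𝔪²`) — the local equations, at a point of a regular surface, of regular curves
through it, each raised to the power `b`. [folklore] -/
def IsAdmissibleDivisor [IsLocalRing R] (b : ℕ) (d : R) : Prop :=
  ∃ s : Multiset R, (∀ ρ ∈ s, Prime ρ ∧ ρ ∉ maximalIdeal R ^ 2) ∧ d = (s.map (· ^ b)).prod

/-- **The normal form** of the ideal `J` under admissible divisions: `⨆ (J : d)` over the admissible divisors `d` with
`J ⊆ (d)`. [folklore] -/
def normalForm [IsLocalRing R] (b : ℕ) (J : Ideal R) : Ideal R :=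
  ⨆ (d : R) (_ : IsAdmissibleDivisor b d ∧ J ≤ Ideal.span {d}), Submodule.colon J (Ideal.span {d})

section Basic

variable [IsLocalRing R] {b : ℕ}

/-- `1` is an admissible divisor (the empty product). [folklore] -/
theorem isAdmissibleDivisor_one (b : ℕ) : IsAdmissibleDivisor (R := R) b 1 :=
  ⟨0, fun _ h => absurd h (Multiset.notMem_zero _), by simp⟩

/-- `ρ^b · d` is admissible for `ρ` a regular-parameter prime and `d` admissible. [folklore] -/
theorem IsAdmissibleDivisor.pow_mul {ρ d : R} (hρ : Prime ρ) (hρ2 : ρ ∉ maximalIdeal R ^ 2)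
    (hd : IsAdmissibleDivisor b d) : IsAdmissibleDivisor b (ρ ^ b * d) := by
  obtain ⟨s, hs, rfl⟩ := hd
  refine ⟨ρ ::ₘ s, fun σ hσ => ?_, by simp⟩
  rcases Multiset.mem_cons.mp hσ with rfl | hσ
  · exact ⟨hρ, hρ2⟩
  · exact hs σ hσ

omit [IsLocalRing R] in
/-- `(J : 1) = J`. [folklore] -/
theorem colon_span_one (J : Ideal R) : Submodule.colon J (Ideal.span {(1 : R)}) = J := by
  rw [Ideal.span_singleton_one]
  ext z
  rw [Submodule.mem_colon]
  constructor
  · intro h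
    simpa using h 1 Submodule.mem_top
  · intro hz p _
    rw [smul_eq_mul]
    exact Ideal.mul_mem_right _ _ hz

/-- `(J : d) ⊆ normalForm b J` for an admissible divisor `d` of `J`. [folklore] -/
theorem colon_le_normalForm {d : R} (hd : IsAdmissibleDivisor b d) {J : Ideal R} (hJ : J ≤ Ideal.span {d}) :
    Submodule.colon J (Ideal.span {d}) ≤ normalForm b J :=
  le_iSup₂ (f := fun (d : R) (_ : IsAdmissibleDivisor b d ∧ J ≤ Ideal.span {d}) => Submodule.colon J (Ideal.span {d}))
    d ⟨hd, hJ⟩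

/-- `J ⊆ normalForm b J`. [folklore] -/
theorem le_normalForm (b : ℕ) (J : Ideal R) : J ≤ normalForm b J := by
  have h := colon_le_normalForm (isAdmissibleDivisor_one (R := R) b) (J := J)
    (by rw [Ideal.span_singleton_one]; exact le_top)
  rwa [colon_span_one] at h

/-- The universal property of the supremum. [folklore] -/
theorem normalForm_le_iff {J I : Ideal R} :
    normalForm b J ≤ I ↔ ∀ d : R, IsAdmissibleDivisor b d → J ≤ Ideal.span {d} → Submodule.colon J (Ideal.span {d}) ≤ I := by
  rw [normalForm, iSup₂_le_iff]
  exact ⟨fun h d hd hJ => h d ⟨hd, hJ⟩, fun h d hd => h d hd.1 hd.2⟩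

end Basic

/-! ## Colon bookkeeping in a domain -/

section Colon

variable [IsDomain R]

omit [IsDomain R] in
/-- `((J : a) : c) = (J : a c)`. [folklore] -/
theorem colon_colon_span_singleton (J : Ideal R) (a c : R) :
    Submodule.colon (Submodule.colon J (Ideal.span {a})) (Ideal.span {c}) = Submodule.colon J (Ideal.span {a * c}) := by
  ext z
  simp only [Submodule.mem_colon, smul_eq_mul]
  constructor
  · intro h w hw
    obtain ⟨t, rfl⟩ := Ideal.mem_span_singleton'.mp hw
    have h1 := h c (Ideal.mem_span_singleton_self c) a (Ideal.mem_span_singleton_self a)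
    have : z * (t * (a * c)) = t * (z * c * a) := by ring
    rw [this]
    exact Ideal.mul_mem_left _ _ h1
  · intro h p hp q hq
    obtain ⟨t, rfl⟩ := Ideal.mem_span_singleton'.mp hp
    obtain ⟨t', rfl⟩ := Ideal.mem_span_singleton'.mp hq
    have h1 := h (a * c) (Ideal.mem_span_singleton_self _)
    have : z * (t * c) * (t' * a) = (t * t') * (z * (a * c)) := by ring
    rw [this]
    exact Ideal.mul_mem_left _ _ h1

omit [IsDomain R] in
/-- Colons by associated elements agree: `(J : u a) = (J : a)` for a unit `u`. [folklore] -/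
theorem colon_span_singleton_unit_mul {u : R} (hu : IsUnit u) (J : Ideal R) (a : R) :
    Submodule.colon J (Ideal.span {u * a}) = Submodule.colon J (Ideal.span {a}) := by
  rw [Ideal.span_singleton_mul_left_unit hu]

omit [IsDomain R] in
/-- `z ∈ (J : a) ↔ z a ∈ J`. [folklore] -/
theorem mem_colon_span_singleton_iff (J : Ideal R) (a z : R) :
    z ∈ Submodule.colon J (Ideal.span {a}) ↔ z * a ∈ J := by
  rw [Submodule.mem_colon]
  constructor
  · intro h
    exact h a (Ideal.mem_span_singleton_self a)
  · intro hz p hp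
    obtain ⟨t, rfl⟩ := Ideal.mem_span_singleton'.mp hp
    rw [smul_eq_mul, show z * (t * a) = t * (z * a) by ring]
    exact Ideal.mul_mem_left _ _ hz

/-- **Coprime cancellation**: if `∏_{σ ∈ s} σ^b ∣ ρ^b · z` for primes `σ` none of which divides the prime `ρ`, then
`∏ σ^b ∣ z`. [folklore] -/
theorem prod_pow_dvd_of_dvd_mul {ρ : R} (b : ℕ) :
    ∀ (s : Multiset R), (∀ σ ∈ s, Prime σ ∧ ¬ σ ∣ ρ) → ∀ z : R, (s.map (· ^ b)).prod ∣ ρ ^ b * z →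
      (s.map (· ^ b)).prod ∣ z := by
  intro s
  induction s using Multiset.induction with
  | empty => intro _ z _; simp
  | cons σ s ih =>
    intro hs z hdvd
    rw [Multiset.map_cons, Multiset.prod_cons] at hdvd ⊢
    have hσ := hs σ (Multiset.mem_cons_self σ s)
    have hs' : ∀ τ ∈ s, Prime τ ∧ ¬ τ ∣ ρ := fun τ hτ => hs τ (Multiset.mem_cons_of_mem hτ)
    -- first the tail divides `z`
    have htail : (s.map (· ^ b)).prod ∣ z := ih hs' z (dvd_trans (Dvd.intro_left _ rfl) hdvd)
    obtain ⟨z₁, rfl⟩ := htail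
    -- then `σ^b ∣ ρ^b z₁`
    have h1 : σ ^ b * (s.map (· ^ b)).prod ∣ (s.map (· ^ b)).prod * (ρ ^ b * z₁) := by
      rw [show (s.map (· ^ b)).prod * (ρ ^ b * z₁) = ρ ^ b * ((s.map (· ^ b)).prod * z₁) by ring]
      exact hdvd
    rw [mul_comm (σ ^ b)] at h1
    by_cases h0 : (s.map (· ^ b)).prod = 0
    · rw [h0, zero_mul]
      exact dvd_zero _
    have h2 : σ ^ b ∣ ρ ^ b * z₁ := (mul_dvd_mul_iff_left h0).mp h1
    have hσρ : ¬ σ ∣ ρ ^ b := fun h => hσ.2 (hσ.1.dvd_of_dvd_pow h)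
    have h3 : σ ^ b ∣ z₁ := hσ.1.pow_dvd_of_dvd_mul_left b hσρ h2
    rw [mul_comm (σ ^ b)]
    exact mul_dvd_mul_left _ h3

end Colon

/-! ## Invariance of the normal form under one admissible division -/

section Invariance

variable [IsLocalRing R] [IsDomain R] {b : ℕ}

omit [IsLocalRing R] in
/-- For `J ⊆ (ρ^b)`: `(J : ρ^b) ⊆ (d)` as soon as `J ⊆ (ρ^b d)`. [folklore] -/
theorem colon_le_span_of_le_span_mul {ρ d : R} {J : Ideal R} (hJ : J ≤ Ideal.span {ρ ^ b * d})
    (hρ0 : ρ ^ b ≠ 0) : Submodule.colon J (Ideal.span {ρ ^ b}) ≤ Ideal.span {d} := by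
  intro z hz
  have h1 : z * ρ ^ b ∈ J := (mem_colon_span_singleton_iff J _ z).mp hz
  obtain ⟨t, ht⟩ := Ideal.mem_span_singleton'.mp (hJ h1)
  rw [Ideal.mem_span_singleton']
  refine ⟨t, mul_right_cancel₀ hρ0 ?_⟩
  rw [← ht]; ring

/-- **One admissible division does not change the normal form**: for a regular-parameter prime `ρ` with `J ⊆ (ρ^b)`,
`normalForm b (J : ρ^b) = normalForm b J`. (`≤`: an admissible divisor `d'` of `(J : ρ^b)` gives the admissible divisor
`ρ^b d'` of `J` with the same colon. `≥`: for an admissible divisor `d = ∏ σ_i^b` of `J`, either some `σ_i` is associated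
to `ρ` and `(J : d) = ((J : ρ^b) : d/σ_i^b)`, or `d` is prime to `ρ`, divides `(J : ρ^b)` by coprime cancellation, and
`(J : d) ⊆ ((J : ρ^b) : d)`.) [folklore] -/
theorem normalForm_colon_eq {ρ : R} (hρ : Prime ρ) (hρ2 : ρ ∉ maximalIdeal R ^ 2) {J : Ideal R}
    (hJ : J ≤ Ideal.span {ρ ^ b}) :
    normalForm b (Submodule.colon J (Ideal.span {ρ ^ b})) = normalForm b J := by
  have hρb0 : ρ ^ b ≠ 0 := pow_ne_zero b hρ.ne_zero
  apply le_antisymm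
  · -- `≤`
    rw [normalForm_le_iff]
    intro d' hd' hJ'
    rw [colon_colon_span_singleton]
    refine colon_le_normalForm (hd'.pow_mul hρ hρ2) ?_
    intro z hz
    obtain ⟨z₁, hz₁⟩ := Ideal.mem_span_singleton'.mp (hJ hz)
    have hz₁J : z₁ ∈ Submodule.colon J (Ideal.span {ρ ^ b}) := by
      rw [mem_colon_span_singleton_iff, hz₁]; exact hz
    obtain ⟨t, ht⟩ := Ideal.mem_span_singleton'.mp (hJ' hz₁J)
    rw [Ideal.mem_span_singleton']
    exact ⟨t, by rw [← hz₁, ← ht]; ring⟩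
  · -- `≥`
    rw [normalForm_le_iff]
    intro d hd hJd
    obtain ⟨s, hs, rfl⟩ := hd
    by_cases hmem : ∃ σ ∈ s, σ ∣ ρ
    · -- some factor is associated to `ρ`
      obtain ⟨σ, hσs, hσρ⟩ := hmem
      obtain ⟨s', rfl⟩ := Multiset.exists_cons_of_mem hσs
      have hσ := (hs σ hσs).1
      -- `σ = u ρ` for a unit... rather `ρ = σ v`, and `σ`, `ρ` associated
      have hassoc : Associated σ ρ := hσ.associated_of_dvd hρ hσρ
      obtain ⟨u, hu⟩ := hassoc
      have hd' : IsAdmissibleDivisor b (s'.map (· ^ b)).prod :=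
        ⟨s', fun τ hτ => hs τ (Multiset.mem_cons_of_mem hτ), rfl⟩
      have hprod : ((σ ::ₘ s').map (· ^ b)).prod = (↑u⁻¹ : R) ^ b * (ρ ^ b * (s'.map (· ^ b)).prod) := by
        rw [Multiset.map_cons, Multiset.prod_cons, ← hu, mul_pow]
        have e1 : (↑u⁻¹ : R) ^ b * (σ ^ b * (↑u : R) ^ b * (s'.map (· ^ b)).prod) =
            ((↑u⁻¹ : R) * ↑u) ^ b * (σ ^ b * (s'.map (· ^ b)).prod) := by ring
        rw [e1, Units.inv_mul, one_pow, one_mul]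
      have hunit : IsUnit ((↑u⁻¹ : R) ^ b) := (Units.isUnit u⁻¹).pow b
      rw [hprod, colon_span_singleton_unit_mul hunit, ← colon_colon_span_singleton]
      refine colon_le_normalForm hd' ?_
      rw [hprod, Ideal.span_singleton_mul_left_unit hunit] at hJd
      exact colon_le_span_of_le_span_mul hJd hρb0
    · -- all factors prime to `ρ`
      push Not at hmem
      have hs' : ∀ σ ∈ s, Prime σ ∧ ¬ σ ∣ ρ := fun σ hσ => ⟨(hs σ hσ).1, hmem σ hσ⟩
      have hd : IsAdmissibleDivisor b (s.map (· ^ b)).prod := ⟨s, hs, rfl⟩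
      -- `(J : ρ^b) ⊆ (d)` by coprime cancellation
      have hle : Submodule.colon J (Ideal.span {ρ ^ b}) ≤ Ideal.span {(s.map (· ^ b)).prod} := by
        intro z hz
        have h1 : z * ρ ^ b ∈ J := (mem_colon_span_singleton_iff J _ z).mp hz
        have h2 : (s.map (· ^ b)).prod ∣ ρ ^ b * z := by
          rw [mul_comm]; exact Ideal.mem_span_singleton.mp (hJd h1)
        exact Ideal.mem_span_singleton.mpr (prod_pow_dvd_of_dvd_mul b s hs' z h2)
      refine le_trans ?_ (colon_le_normalForm hd hle)
      -- `(J : d) ⊆ ((J : ρ^b) : d)` as `J ⊆ (J : ρ^b)`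
      refine Submodule.colon_mono ?_ le_rfl
      intro z hz
      rw [mem_colon_span_singleton_iff]
      exact Ideal.mul_mem_right _ _ hz

end Invariance

/-! ## Ideals of isolated type are their own normal form -/

section Isolated

variable [IsLocalRing R] {b : ℕ}

/-- The only admissible divisors of an ideal of isolated type are units (`b > 0`): a non-empty product `∏ σ_i^b ⊇ J`
would give `J ⊆ (σ_1^b)`. [folklore] -/
theorem isUnit_of_isAdmissibleDivisor_of_isolated {J : Ideal R} (hiso : ∀ q : R, Prime q → ¬ J ≤ Ideal.span {q ^ b})
    {d : R} (hd : IsAdmissibleDivisor b d) (hJd : J ≤ Ideal.span {d}) : IsUnit d := by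
  obtain ⟨s, hs, rfl⟩ := hd
  induction s using Multiset.induction with
  | empty => simp
  | cons σ s _ =>
    exfalso
    apply hiso σ (hs σ (Multiset.mem_cons_self σ s)).1
    refine hJd.trans ?_
    rw [Ideal.span_singleton_le_span_singleton, Multiset.map_cons, Multiset.prod_cons]
    exact Dvd.intro _ rfl

/-- **An ideal of isolated type is its own normal form** (no regular curve of the singular locus passes through the
point, so no admissible division is possible). [folklore] -/
theorem normalForm_eq_self_of_isolated {J : Ideal R} (hiso : ∀ q : R, Prime q → ¬ J ≤ Ideal.span {q ^ b}) :
    normalForm b J = J := by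
  refine le_antisymm ?_ (le_normalForm b J)
  rw [normalForm_le_iff]
  intro d hd hJd
  have hu := isUnit_of_isAdmissibleDivisor_of_isolated hiso hd hJd
  rw [Ideal.span_singleton_eq_top.mpr hu]
  intro z hz
  have := (Submodule.mem_colon.mp hz) 1 Submodule.mem_top
  simpa using this

end Isolated

/-! ## Transport along a ring isomorphism -/

section Transport

variable {R' : Type u} [CommRing R'] [IsLocalRing R] [IsLocalRing R'] {b : ℕ}

/-- Admissible divisors transport along a ring isomorphism. [folklore] -/
theorem IsAdmissibleDivisor.map (e : R ≃+* R') {d : R} (hd : IsAdmissibleDivisor b d) :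
    IsAdmissibleDivisor b (e d) := by
  obtain ⟨s, hs, rfl⟩ := hd
  refine ⟨s.map e, fun ρ' hρ' => ?_, ?_⟩
  · obtain ⟨ρ, hρ, rfl⟩ := Multiset.mem_map.mp hρ'
    obtain ⟨hp, h2⟩ := hs ρ hρ
    refine ⟨(MulEquiv.prime_iff e.toMulEquiv).mpr hp, fun hmem => h2 ?_⟩
    have h1 : e.symm (e ρ) ∈ (maximalIdeal R' ^ 2).map e.symm := Ideal.mem_map_of_mem e.symm hmem
    rw [e.symm_apply_apply, Ideal.map_pow, IsLocalRing.map_ringEquiv_maximalIdeal e.symm] at h1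
    exact h1
  · rw [map_multiset_prod, Multiset.map_map, Multiset.map_map]
    congr 1
    apply Multiset.map_congr rfl
    intro x _
    simp

omit [IsLocalRing R] [IsLocalRing R'] in
/-- `e((J : (d))) = (e(J) : (e d))`. [folklore] -/
theorem map_colon_span_singleton (e : R ≃+* R') (J : Ideal R) (d : R) :
    (Submodule.colon J (Ideal.span {d})).map (e : R →+* R') = Submodule.colon (J.map (e : R →+* R')) (Ideal.span {e d}) := by
  ext w
  constructor
  · intro hw
    obtain ⟨z, hz, rfl⟩ := (Ideal.mem_map_of_equiv e w).mp hw
    rw [Submodule.mem_colon]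
    intro p hp
    obtain ⟨t, rfl⟩ := Ideal.mem_span_singleton'.mp hp
    rw [smul_eq_mul, show e z * (t * e d) = t * e (z * d) by rw [map_mul]; ring]
    refine Ideal.mul_mem_left _ _ (Ideal.mem_map_of_mem _ ?_)
    exact (Submodule.mem_colon.mp hz) d (Ideal.mem_span_singleton_self d)
  · intro hw
    refine (Ideal.mem_map_of_equiv e w).mpr ⟨e.symm w, ?_, e.apply_symm_apply w⟩
    rw [Submodule.mem_colon]
    intro p hp
    obtain ⟨t, rfl⟩ := Ideal.mem_span_singleton'.mp hp
    have h1 := (Submodule.mem_colon.mp hw) (e d) (Ideal.mem_span_singleton_self _)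
    rw [smul_eq_mul] at h1 ⊢
    obtain ⟨v, hv, hve⟩ := (Ideal.mem_map_of_equiv e _).mp h1
    have : v = e.symm w * d := e.injective (by rw [hve, map_mul, e.apply_symm_apply])
    rw [show e.symm w * (t * d) = t * (e.symm w * d) by ring]
    rw [this] at hv
    exact Ideal.mul_mem_left _ _ hv

/-- **The normal form transports along a ring isomorphism.** [folklore] -/
theorem map_normalForm (e : R ≃+* R') (J : Ideal R) :
    (normalForm b J).map (e : R →+* R') = normalForm b (J.map (e : R →+* R')) := by
  apply le_antisymm
  · rw [normalForm, Ideal.map_iSup]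
    refine iSup_le fun d => ?_
    rw [Ideal.map_iSup]
    refine iSup_le fun hd => ?_
    rw [map_colon_span_singleton]
    refine colon_le_normalForm (hd.1.map e) ?_
    have := Ideal.map_mono (f := (e : R →+* R')) hd.2
    rwa [Ideal.map_span, Set.image_singleton] at this
  · rw [normalForm_le_iff]
    intro d' hd' hJ'
    -- pull back `d'`
    have hd : IsAdmissibleDivisor b (e.symm d') := hd'.map e.symm
    have hJ : J ≤ Ideal.span {e.symm d'} := by
      have := Ideal.map_mono (f := (e.symm : R' →+* R)) hJ'
      rw [Ideal.map_span, Set.image_singleton] at this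
      refine le_trans ?_ this
      intro z hz
      exact (Ideal.mem_map_of_equiv e.symm z).mpr ⟨e z, Ideal.mem_map_of_mem _ hz, e.symm_apply_apply z⟩
    have h1 := Ideal.map_mono (f := (e : R →+* R')) (colon_le_normalForm hd hJ)
    rw [map_colon_span_singleton, e.apply_symm_apply] at h1
    exact h1

end Transport

end Summit.ResolutionOfSingularities.ResolutionOfSingularities.Theorems.CampaignW46

end
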